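import Summits.AnomalousDissipation.AnomalousDissipation.Theorems.MarginalStabilityChainStrainedLayerLawClockLine
import Summits.AnomalousDissipation.AnomalousDissipation.Theorems.MarginalStabilityChainStrainedLayerLawStubStrainWorkIdentityA
import Summits.AnomalousDissipation.AnomalousDissipation.Theorems.MarginalStabilityChainStrainedLayerLawStubExcessEnergyKinematicA
import HarnessLib

/-!
# Stub `stub_circulationFloor` of line `FirstLemmasR2K4` (log-enstrophy clock; crux `MarginalStabilityChain.StrainedLayerLaw`,
# stmt-AnomalousDissipation-3007) — PROVED

Support file (`--supports stmt-AnomalousDissipation-3007`) proving the registered stub `stub_circulationFloor` BY NAME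
with its registered signature: the CIRCULATION FLOOR `L ≤ M₋ = negMass L u v` for one `C²` slice `(u, v)`,
`L`-periodic in `x` (`L > 0`), with the shear far field `u → ±½` (`y → ±∞`) and shear tails `SliceTails C k u v`
(`k > 0`). It is the hypothesis `M₋(t) ≥ L` of the log-enstrophy clock transfer `clockTransfer` of the line
(`…Theorems.MarginalStabilityChainStrainedLayerLawClockLine`).

Route of proof (circulation budget of one period cell): with `ω = ∂ₓv − ∂_yu`,
* for every `x`, `∫_y ∂_yu(x, y) dy = ½ − (−½) = 1` (fundamental theorem of calculus on the whole line for the `C¹`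
  slice `y ↦ u(x, y)`, Mathlib's `integral_of_hasDerivAt_of_tendsto`; `∂_yu(x, ·)` is integrable because
  `|∂_yu| ≤ Ce^{−k|y|}`), so `∫_y (−ω)(x, y) dy = 1 − ∫_y ∂ₓv(x, y) dy`, and `ω₋ = max(−ω, 0) ≥ −ω` gives
  `∫_y ω₋(x, y) dy ≥ 1 − ∫_y ∂ₓv(x, y) dy` (monotonicity of the Bochner integral, both sides integrable);
* integrating over `x ∈ (0, L]` (both sides integrable in `x`, by Fubini from integrability on the strip,
  `integrableOn_strip_of_abs_le_exp`): `M₋ ≥ L − ∫_{x ∈ (0,L]} ∫_y ∂ₓv`;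
* `∫_{x ∈ (0,L]} ∫_y ∂ₓv = ∫_y ∫₀ᴸ ∂ₓv dx dy = ∫_y (v(L, y) − v(0, y)) dy = 0` (Fubini and periodicity,
  `intervalIntegral_dX_period_eq_zero`).
The divergence-free condition is not needed. No facts are cited; everything is folklore calculus.

References: idea card `Cruxes/StrainedLayerLaw/Ideas/log-enstrophy-clock-nash-roundness.md` (card B2, circulation
floor); A. J. Majda, A. L. Bertozzi, *Vorticity and Incompressible Flow*, CUP 2002, §1.4 (circulation of the shear
layer per period equals the velocity jump times the period).
-/

-- `Summit.<Summit>.<Problem>` is the tree's mandated summit-side namespace (CONVENTIONS §2); for this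
-- single-conjunct summit the two coincide, so the duplicate is deliberate.
set_option linter.dupNamespace false

noncomputable section

open scoped Topology ENNReal
open Filter Set Function MeasureTheory

namespace Summit.AnomalousDissipation.AnomalousDissipation.Theorems.StrainedLayerLaw.LogEnstrophyClock

open Literature.Analysis.FluidPDE Literature.Analysis.FluidPDE.StretchedLayer
open Summit.AnomalousDissipation.AnomalousDissipation.Theses.MarginalStabilityChain
open Summit.AnomalousDissipation.AnomalousDissipation.Theorems.StrainedLayerLaw.StrainWorkSumRule

/-! ## One-variable tools across the layer -/

/-- The layer weight `y ↦ e^{−k|y|}` is integrable on `ℝ` for `k > 0` (private copy, from the tree's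
`integrable_one_add_abs_sq_mul_exp` and `e^{−k|y|} ≤ (1 + |y|)²e^{−k|y|}`; the public one-variable versions
`Literature.Analysis.Complex.integrable_exp_neg_mul_abs` etc. are not in this import closure). [folklore] -/
private theorem integrable_exp_neg_mul_abs_floor {k : ℝ} (hk : 0 < k) :
    Integrable fun y : ℝ => Real.exp (-k * |y|) :=
  (integrable_one_add_abs_sq_mul_exp hk).mono' (by fun_prop)
    (Eventually.of_forall fun y => by
      rw [Real.norm_of_nonneg (Real.exp_pos _).le]
      exact exp_le_one_add_abs_sq_mul_exp k y)

/-- A continuous function on `ℝ` dominated by `Ce^{−k|y|}`, `k > 0`, is integrable. [folklore] -/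
theorem integrable_slice_of_abs_le_exp {F : ℝ → ℝ} (hF : Continuous F) {C k : ℝ} (hk : 0 < k)
    (h : ∀ y, |F y| ≤ C * Real.exp (-k * |y|)) : Integrable F :=
  ((integrable_exp_neg_mul_abs_floor hk).const_mul C).mono' hF.aestronglyMeasurable
    (Eventually.of_forall fun y => by rw [Real.norm_eq_abs]; exact h y)

/-- **The velocity jump across the layer**: for a `C¹` plane field `u` with `u(x, ·) → ½` at `+∞`, `→ −½` at `−∞`
and `|∂_yu| ≤ Ce^{−k|y|}` (`k > 0`), `∫_y ∂_yu(x, y) dy = 1` for every `x` (fundamental theorem of calculus on the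
whole line). [folklore] -/
theorem integral_dY_shear_eq_one {u : ℝ → ℝ → ℝ} (hu : ContDiff ℝ 1 (fun q : ℝ × ℝ => u q.1 q.2)) {C k : ℝ}
    (hk : 0 < k) (hdec : ∀ x y, |dY u x y| ≤ C * Real.exp (-k * |y|))
    (htop : ∀ x, Tendsto (fun y => u x y) atTop (𝓝 (1 / 2)))
    (hbot : ∀ x, Tendsto (fun y => u x y) atBot (𝓝 (-(1 / 2)))) (x : ℝ) :
    ∫ y, dY u x y = 1 := by
  have hI : Integrable fun y => dY u x y :=
    integrable_slice_of_abs_le_exp (continuous_slice_y (continuous_dY hu) x) hk (hdec x)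
  rw [integral_of_hasDerivAt_of_tendsto (fun y => hasDerivAt_dY_of_contDiff hu one_ne_zero x y) hI
    (hbot x) (htop x)]
  norm_num

/-- **The period integral of `∂ₓv` has zero transverse integral**: for a `C¹` plane field `v`, `L`-periodic in `x`
(`0 ≤ L`), with `|∂ₓv| ≤ Ce^{−k|y|}` (`C ≥ 0`, `k > 0`), `∫_{x ∈ (0,L]} ∫_y ∂ₓv(x, y) = 0` (Fubini on the strip
and `∫₀ᴸ ∂ₓv dx = v(L, y) − v(0, y) = 0`). [folklore] -/
theorem integral_period_integral_dX_eq_zero {v : ℝ → ℝ → ℝ} (hv : ContDiff ℝ 1 (fun q : ℝ × ℝ => v q.1 q.2))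
    {L C k : ℝ} (hL : 0 ≤ L) (hC : 0 ≤ C) (hk : 0 < k) (hper : ∀ x y, v (x + L) y = v x y)
    (hdec : ∀ x y, |dX v x y| ≤ C * Real.exp (-k * |y|)) :
    ∫ x in Ioc 0 L, ∫ y, dX v x y = 0 := by
  have hI : IntegrableOn (fun q : ℝ × ℝ => dX v q.1 q.2) (Ioc 0 L ×ˢ univ) :=
    integrableOn_strip_of_abs_le_exp (continuous_dX hv) hC hk fun x _ y => hdec x y
  rw [IntegrableOn, volume_restrict_strip] at hI
  have h1 : ∫ x in Ioc 0 L, ∫ y, dX v x y =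
      ∫ q, dX v q.1 q.2 ∂((volume : Measure ℝ).restrict (Ioc 0 L)).prod (volume : Measure ℝ) := by
    rw [integral_prod _ hI]
  rw [h1, integral_prod_symm _ hI]
  have h2 : ∀ y, ∫ x in Ioc 0 L, dX v x y = 0 := fun y => by
    rw [← intervalIntegral.integral_of_le hL]
    exact intervalIntegral_dX_period_eq_zero hv hper y
  simp only [h2, integral_zero]

/-! ## The stub -/

/-- **Registered stub `stub_circulationFloor` of the line `FirstLemmasR2K4` (crux `StrainedLayerLaw`,
stmt-AnomalousDissipation-3007): the circulation floor.** For a `C²` slice `(u, v)`, `L`-periodic in `x` (`L > 0`),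
with the shear far field `u → ±½` and shear tails `SliceTails C k u v` (`k > 0`), the mass of the negative vorticity
over one period cell is at least the period: `L ≤ negMass L u v = ∫_{x ∈ (0,L]} ∫_y max(−ω, 0)`. Indeed
`∫_y (−ω)(x, ·) = ∫_y ∂_yu − ∫_y ∂ₓv = 1 − ∫_y ∂ₓv(x, ·)` for every `x`, `max(−ω, 0) ≥ −ω`, and
`∫_{x ∈ (0,L]} ∫_y ∂ₓv = 0` by periodicity. [folklore] -/
theorem stub_circulationFloor : ∀ (L C k : ℝ), 0 < L → 0 < k → ∀ (u v : ℝ → ℝ → ℝ),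
    ContDiff ℝ 2 (fun q : ℝ × ℝ => u q.1 q.2) → ContDiff ℝ 2 (fun q : ℝ × ℝ => v q.1 q.2) →
    (∀ x y, u (x + L) y = u x y) → (∀ x y, v (x + L) y = v x y) →
    (∀ x, Tendsto (fun y => u x y) atTop (𝓝 (1 / 2))) →
    (∀ x, Tendsto (fun y => u x y) atBot (𝓝 (-(1 / 2)))) →
    SliceTails C k u v → L ≤ negMass L u v := by
  intro L C k hL hk u v hu hv _hpu hpv hut hub hT
  have hC : 0 ≤ C := hT.nonneg
  have hu1 : ContDiff ℝ 1 (fun q : ℝ × ℝ => u q.1 q.2) := hu.of_le one_le_two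
  have hv1 : ContDiff ℝ 1 (fun q : ℝ × ℝ => v q.1 q.2) := hv.of_le one_le_two
  have cuy : Continuous (fun q : ℝ × ℝ => dY u q.1 q.2) := continuous_dY hu1
  have cvx : Continuous (fun q : ℝ × ℝ => dX v q.1 q.2) := continuous_dX hv1
  have cω : Continuous (fun q : ℝ × ℝ => vorticity u v q.1 q.2) := cvx.sub cuy
  -- the tails of `∂_yu`, `∂ₓv`, `ω` and `ω₋`
  have huy : ∀ x y, |dY u x y| ≤ C * Real.exp (-k * |y|) := fun x y => hT.abs_dY_u_le x y
  have hvx : ∀ x y, |dX v x y| ≤ C * Real.exp (-k * |y|) := fun x y => hT.abs_dX_v_le x y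
  have hω : ∀ x y, |vorticity u v x y| ≤ C * Real.exp (-k * |y|) := fun x y => by
    have h := (hT x y).2.2.1
    calc |vorticity u v x y| = |dX v x y - dY u x y| := rfl
      _ ≤ |dX v x y| + |dY u x y| := abs_sub _ _
      _ ≤ C * Real.exp (-k * |y|) := by linarith [abs_nonneg (dX u x y), abs_nonneg (dY v x y)]
  have hωm : ∀ x y, |max (-(vorticity u v x y)) 0| ≤ C * Real.exp (-k * |y|) := fun x y => by
    refine le_trans ?_ (hω x y)
    rw [abs_of_nonneg (le_max_right _ _)]
    exact max_le (neg_le_abs _) (abs_nonneg _)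
  -- slice integrability (every `x`)
  have iuy : ∀ x, Integrable fun y => dY u x y := fun x =>
    integrable_slice_of_abs_le_exp (continuous_slice_y cuy x) hk (huy x)
  have ivx : ∀ x, Integrable fun y => dX v x y := fun x =>
    integrable_slice_of_abs_le_exp (continuous_slice_y cvx x) hk (hvx x)
  have iω : ∀ x, Integrable fun y => vorticity u v x y := fun x =>
    integrable_slice_of_abs_le_exp (continuous_slice_y cω x) hk (hω x)
  -- the slice inequality `1 − ∫_y ∂ₓv(x, ·) ≤ ∫_y ω₋(x, ·)`
  have inner : ∀ x, 1 - ∫ y, dX v x y ≤ ∫ y, max (-(vorticity u v x y)) 0 := fun x => by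
    have h1 : ∫ y, dY u x y = 1 := integral_dY_shear_eq_one hu1 hk huy hut hub x
    have h2 : ∫ y, -(vorticity u v x y) = 1 - ∫ y, dX v x y := by
      have h3 : (fun y => -(vorticity u v x y)) = fun y => dY u x y - dX v x y := by
        funext y
        simp only [StrainWorkSumRule.vorticity]
        ring
      rw [h3, integral_sub (iuy x) (ivx x), h1]
    rw [← h2]
    exact integral_mono (iω x).neg (iω x).neg_part fun y => le_max_left _ _
  -- integrability in `x` of the two slice functionals (Fubini from the strip)
  have iNeg : IntegrableOn (fun q : ℝ × ℝ => max (-(vorticity u v q.1 q.2)) 0) (Ioc 0 L ×ˢ univ) :=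
    integrableOn_strip_of_abs_le_exp (cω.neg.max continuous_const) hC hk fun x _ y => hωm x y
  have iVx : IntegrableOn (fun q : ℝ × ℝ => dX v q.1 q.2) (Ioc 0 L ×ˢ univ) :=
    integrableOn_strip_of_abs_le_exp cvx hC hk fun x _ y => hvx x y
  rw [IntegrableOn, volume_restrict_strip] at iNeg iVx
  have iNeg' : Integrable (fun x => ∫ y, max (-(vorticity u v x y)) 0) (volume.restrict (Ioc 0 L)) :=
    iNeg.integral_prod_left
  have iVx' : Integrable (fun x => 1 - ∫ y, dX v x y) (volume.restrict (Ioc 0 L)) :=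
    (integrable_const (c := (1:ℝ))).sub iVx.integral_prod_left
  -- `∫_{x ∈ (0,L]} ∫_y ∂ₓv = 0`
  have hVx0 : ∫ x in Ioc 0 L, ∫ y, dX v x y = 0 :=
    integral_period_integral_dX_eq_zero hv1 hL.le hC hk hpv hvx
  -- assemble
  calc L = ∫ x in Ioc 0 L, (1 - ∫ y, dX v x y) := by
        rw [integral_sub (integrable_const _) iVx.integral_prod_left, hVx0, sub_zero,
          setIntegral_const, Real.volume_real_Ioc_of_le hL.le, sub_zero, smul_eq_mul, mul_one]
    _ ≤ ∫ x in Ioc 0 L, ∫ y, max (-(vorticity u v x y)) 0 := integral_mono iVx' iNeg' inner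
    _ = negMass L u v := rfl

end Summit.AnomalousDissipation.AnomalousDissipation.Theorems.StrainedLayerLaw.LogEnstrophyClock

end
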